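import Mathlib
import HarnessLib
import Summits.Ventures.LatticeQCDFlow.Exactness.Overrelaxation

/-!
# Over-relaxation alone is exact but not ergodic: every function of the action is invariant, and a deterministic move is never Doeblin

HONEST FRAMING: exact (Metropolis-corrected) sampling algorithms for lattice gauge theory;
figures of merit are autocorrelation/cost numbers at stated couplings and volumes; no
continuum-physics claim.

Venture `LatticeQCDFlow` (cell pub-lqcd), topic `Exactness`, FANOUT row 9 (eng-latcore, the
engine `latflow.core`).  NEW WORK of the cell over Mathlib and gen-6's `Overrelaxation.lean`
(`microcanonical_invariant`: a `vol`-preserving involution conserving `H` leaves `e^{−H} vol`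
invariant; `reflectThrough s : g ↦ s g⁻¹ s`).  Nothing is cited as a fact.  Printed counterpart,
NAMED ONLY: Adler 1981 / Creutz 1987 (over-relaxation must be mixed with an ergodic update).

Row 9's ergodicity files (`HeatBathSweepErgodic.lean`, `DoeblinUniqueness.lean`) say in words that
the OVER-RELAXATION sweeps of the engine's composite sweep are "exact but not ergodic on their own"
and that ergodicity comes from the heat bath.  This file types the negative half.

## What is proved

* `invariant_deterministic_iff` — a deterministic kernel leaves `m` invariant iff its map
  preserves `m` (`m.map Φ = m`).
* **`microcanonical_invariant_of_conserved`** — if `Φ` preserves `vol` and conserves `H`, then for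
  EVERY measurable `g : ℝ → ℝ≥0∞` the measure `g(H) · vol` is invariant under the deterministic
  move: a continuum of invariant laws (all "microcanonical" reweightings), so the move alone cannot
  converge to the Gibbs law from a general start; `overrelaxation_invariant_of_conserved` — the
  group instance `g ↦ s g⁻¹ s` with Haar.
* **`deterministic_not_minorised`** — a deterministic Markov kernel whose map takes two distinct
  values admits NO Doeblin minorisation `κ(a,·) ≥ ε ν` with `ε > 0` and `ν` a probability law
  (countably separated state space); `reflectThrough_not_minorised` — in particular the
  over-relaxation reflection on any non-trivial group.  Contrast: the heat-bath scan IS Doeblin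
  (`heatBathSweep_minorised`), and HB followed by OR sweeps inherits it
  (`heatBathSweep_comp_uniformlyErgodic`).

NOT CLAIMED: that HB + OR mixes FASTER than HB (the reason OR is used) — a quantitative statement
the cell measures, not types.
-/

namespace Summit.Ventures.LatticeQCDFlow.Exactness

open MeasureTheory ProbabilityTheory
open scoped ENNReal

section Deterministic

variable {Ω : Type*} [MeasurableSpace Ω]

/-- A deterministic kernel leaves `m` invariant iff its map preserves `m`. -/
theorem invariant_deterministic_iff {Φ : Ω → Ω} (hΦ : Measurable Φ) (m : Measure Ω) :
    Kernel.Invariant (Kernel.deterministic Φ hΦ) m ↔ m.map Φ = m := by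
  rw [Kernel.Invariant, ← Measure.deterministic_comp_eq_map hΦ]

/-- **Every function of a conserved quantity gives an invariant law of the deterministic move.**
If `Φ` preserves `vol` and `H ∘ Φ = H`, then `g(H) · vol` is invariant for every measurable `g`. -/
theorem microcanonical_invariant_of_conserved {vol : Measure Ω} {H : Ω → ℝ} {Φ : Ω → Ω}
    (hHm : Measurable H) (hvol : MeasurePreserving Φ vol vol) (hH : ∀ x, H (Φ x) = H x)
    {g : ℝ → ℝ≥0∞} (hg : Measurable g) :
    Kernel.Invariant (Kernel.deterministic Φ hvol.measurable) (vol.withDensity fun x => g (H x)) := by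
  have hgH : Measurable fun x => g (H x) := hg.comp hHm
  rw [invariant_deterministic_iff]
  ext s hs
  rw [Measure.map_apply hvol.measurable hs, withDensity_apply _ (hvol.measurable hs), withDensity_apply _ hs,
    ← hvol.setLIntegral_comp_preimage hs hgH]
  refine setLIntegral_congr_fun (hvol.measurable hs) fun x _ => ?_
  simp only [hH x]

/-- **A deterministic move is never Doeblin**: if `Φ a ≠ Φ a'` for some states (singletons
measurable), no `ε > 0` and probability law `ν` satisfy `ε ν ≤ δ_{Φ x}` for all `x`. -/
theorem deterministic_not_minorised [MeasurableSingletonClass Ω] {Φ : Ω → Ω} (hΦ : Measurable Φ)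
    {a a' : Ω} (hne : Φ a ≠ Φ a') {ε : ℝ≥0∞} (hε : 0 < ε) {ν : Measure Ω} [IsProbabilityMeasure ν]
    (hmin : ∀ x, ε • ν ≤ Kernel.deterministic Φ hΦ x) : False := by
  -- `ν` is carried by `{Φ x}` for every `x`
  have hone : ∀ x, ν {Φ x} = 1 := fun x => by
    have h := Measure.le_iff.1 (hmin x) {Φ x}ᶜ (measurableSet_singleton _).compl
    rw [Measure.smul_apply, smul_eq_mul, Kernel.deterministic_apply,
      Measure.dirac_apply' _ (measurableSet_singleton _).compl, Set.indicator_of_notMem (Set.notMem_compl_iff.2 (Set.mem_singleton _))] at h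
    have h0 : ν {Φ x}ᶜ = 0 := (mul_eq_zero.1 (le_zero_iff.1 h)).resolve_left hε.ne'
    exact (prob_compl_eq_zero_iff (measurableSet_singleton _)).1 h0
  -- two disjoint atoms of mass one: impossible for a probability law
  have hdisj : Disjoint ({Φ a} : Set Ω) {Φ a'} := Set.disjoint_singleton.2 hne
  have h2 : ν ({Φ a} ∪ {Φ a'}) = 2 := by
    rw [measure_union hdisj (measurableSet_singleton _), hone a, hone a']
    norm_num
  have hle : ν ({Φ a} ∪ {Φ a'}) ≤ 1 := prob_le_one
  rw [h2] at hle
  exact absurd hle (by norm_num)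

end Deterministic

/-! ## The group instance: `g ↦ s g⁻¹ s` -/

section Group

variable {G : Type*} [Group G] [MeasurableSpace G] [MeasurableMul G] [MeasurableInv G]

/-- **Every function of a conserved action is invariant under over-relaxation**: for a left-,
right- and inversion-invariant `μ` (Haar of a compact group), an action with `H (s g⁻¹ s) = H g`
and every measurable `g : ℝ → ℝ≥0∞`, the law `g(H) · μ` is invariant under `g ↦ s g⁻¹ s`. -/
theorem overrelaxation_invariant_of_conserved {μ : Measure G} [μ.IsMulLeftInvariant]
    [μ.IsMulRightInvariant] [μ.IsInvInvariant] {H : G → ℝ} (hHm : Measurable H) (s : G)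
    (hH : ∀ g, H (s * g⁻¹ * s) = H g) {w : ℝ → ℝ≥0∞} (hw : Measurable w) :
    Kernel.Invariant
      (Kernel.deterministic (reflectThrough s) (measurePreserving_reflectThrough μ s).measurable)
      (μ.withDensity fun g => w (H g)) :=
  microcanonical_invariant_of_conserved hHm (measurePreserving_reflectThrough μ s) (fun g => hH g) hw

omit [MeasurableMul G] [MeasurableInv G] in
/-- **Over-relaxation alone is never Doeblin** on a non-trivial group: the reflection `g ↦ s g⁻¹ s`
is injective, so it takes two values, and `deterministic_not_minorised` applies. -/
theorem reflectThrough_not_minorised [MeasurableSingletonClass G] [Nontrivial G] (s : G)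
    (hΦ : Measurable (reflectThrough s)) {ε : ℝ≥0∞} (hε : 0 < ε) {ν : Measure G}
    [IsProbabilityMeasure ν] (hmin : ∀ x, ε • ν ≤ Kernel.deterministic (reflectThrough s) hΦ x) :
    False := by
  obtain ⟨a, a', hne⟩ := exists_pair_ne G
  exact deterministic_not_minorised hΦ ((reflectThrough s).injective.ne hne) hε hmin

end Group

end Summit.Ventures.LatticeQCDFlow.Exactness
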